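import Mathlib
import Literature.Computability.MetaComplexity.SmolenskyDimensionBound
import Literature.Computability.MetaComplexity.SmolenskyRows

/-!
# The Liouville–polynomial correlation counts agreements on the cube

Helper for line Sketch/LAR of crux stmt-QuantumAdvantage-1392. For a polynomial
`P ∈ 𝔽₂[x_0, …, x_{n-1}]`, the correlation

  `Σ_{N < 2ⁿ} λ(N) · (−1)^{[P(bits N) = 1]}`

of the Liouville function with the sign of `P` read on the binary digits of `N` is at most
`2·|{b ∈ {0,1}ⁿ : f b = p b}| − 2ⁿ + 1`, where `f b = 1_{λ(val b) = −1}` and `p b = P(b)` are the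
two `𝔽₂`-valued functions on the cube and `val b = boolFunEquivFin n b` is the number with digits
`b`. Proof: reindex `N = val b` (the digits of `val b` are `b`, `testBit_boolFunEquivFin`); for
`N ≥ 1`, `λ(N) = ±1` and the summand is `+1` exactly when `f b = p b`, else `−1`; the term `N = 0`
is `0 ≤ 2·[agree] − 1 + 1`.
-/

namespace Summit.QuantumAdvantage.DigitPolyUniformity.SketchLAR

open Finset Module
open Literature.Computability.MetaComplexity (boolFunEquivFin)
open Literature.Computability.MetaComplexity.Smolensky (CubeFn mono lowDeg)

namespace CorrLeCard

/-- **Pointwise comparison.** For `N : ℕ` and a value `u ∈ 𝔽₂`: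
`λ(N)·(−1)^{[u = 1]} ≤ 2·[f = u] − 1 + [N = 0]` with `f = 1_{λ(N) = −1} ∈ 𝔽₂` (for `N ≥ 1`,
`λ(N) = ±1` and the left side is `+1` iff `f = u`; for `N = 0` the left side vanishes).
[folklore] -/
theorem pointwise (N : ℕ) (u : ZMod 2) :
    ((ArithmeticFunction.liouville N : ℤ) : ℝ) * (if u = 1 then (-1 : ℝ) else 1) ≤
      2 * (if (if ArithmeticFunction.liouville N = -1 then (1 : ZMod 2) else 0) = u
          then (1 : ℝ) else 0) - 1 +
        (if N = 0 then (1 : ℝ) else 0) := by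
  have hu : u = 0 ∨ u = 1 := by revert u; decide
  rcases eq_or_ne N 0 with rfl | hN
  · simp only [ArithmeticFunction.map_zero, Int.cast_zero, zero_mul, if_true]
    rcases hu with rfl | rfl <;> simp
  · have hl : ArithmeticFunction.liouville N = 1 ∨ ArithmeticFunction.liouville N = -1 := by
      rw [ArithmeticFunction.liouville_apply hN]
      exact neg_one_pow_eq_or ℤ _
    simp only [hN, if_false, add_zero]
    rcases hl with hl | hl <;> rcases hu with rfl | rfl <;> simp [hl] <;> norm_num

/-- **The digits of `val b` are `b`**: the evaluation point read off the bits of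
`boolFunEquivFin n b` is the point `b` itself (as a `0/1`-vector in `𝔽₂ⁿ`). [folklore] -/
theorem evalPoint_eq {n : ℕ} (b : Fin n → Bool) :
    (fun i : Fin n => if Nat.testBit ((boolFunEquivFin n b : Fin (2 ^ n)) : ℕ) i
        then (1 : ZMod 2) else 0) =
      fun i => if b i then (1 : ZMod 2) else 0 := by
  funext i
  rw [Literature.Computability.MetaComplexity.Smolensky.testBit_boolFunEquivFin]

/-- **Exactly one point of the cube has value `0`**:
`Σ_b [val b = 0] = 1` (reindex through `boolFunEquivFin` to `Σ_{N < 2ⁿ} [N = 0]`). [folklore] -/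
theorem sum_ite_val_eq_zero (n : ℕ) :
    ∑ b : Fin n → Bool, (if ((boolFunEquivFin n b : Fin (2 ^ n)) : ℕ) = 0 then (1 : ℝ) else 0) =
      1 := by
  rw [Equiv.sum_comp (boolFunEquivFin n)
      (fun k : Fin (2 ^ n) => if (k : ℕ) = 0 then (1 : ℝ) else 0),
    Fin.sum_univ_eq_sum_range (fun N => if N = 0 then (1 : ℝ) else 0) (2 ^ n),
    Finset.sum_ite_eq' (range (2 ^ n)) 0 (fun _ => (1 : ℝ)), if_pos]
  exact mem_range.2 (Nat.two_pow_pos n)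

end CorrLeCard

/-- **The correlation counts agreements.** With `f(b) = 1_{λ(val b) = −1}` and
`p(b) = P(b) ∈ 𝔽₂`: `Σ_{N<2^n} λ(N)(−1)^{[P(bits N) = 1]} ≤ 2·|{b : f b = p b}| − 2^n + 1`
(reindex `N = val b` via `boolFunEquivFin`, whose digits are `b`; for `N ≥ 1`, `λ(N) = ±1` and the
summand is `+1` iff `f b = p b`; the term `N = 0` is `0 ≤ 2·[agree] − 1 + 1`). [folklore] -/
theorem stub_corr_le_card {n : ℕ} (P : MvPolynomial (Fin n) (ZMod 2)) :
    ∑ N ∈ range (2 ^ n), ((ArithmeticFunction.liouville N : ℤ) : ℝ) *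
        (if MvPolynomial.eval (fun i : Fin n => if Nat.testBit N i then (1 : ZMod 2) else 0) P = 1
          then (-1 : ℝ) else 1) ≤
      2 * ((univ.filter fun b : Fin n → Bool =>
            (if ArithmeticFunction.liouville ((boolFunEquivFin n b : Fin (2 ^ n)) : ℕ) = -1
              then (1 : ZMod 2) else 0) =
            MvPolynomial.eval (fun i => if b i then (1 : ZMod 2) else 0) P).card : ℝ) -
        2 ^ n + 1 := by
  -- the summand as a function of `N`
  set g : ℕ → ℝ := fun N => ((ArithmeticFunction.liouville N : ℤ) : ℝ) *
      (if MvPolynomial.eval (fun i : Fin n => if Nat.testBit N i then (1 : ZMod 2) else 0) P = 1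
        then (-1 : ℝ) else 1) with hg
  -- (1) reindex the sum over the cube
  have h1 : ∑ N ∈ range (2 ^ n), g N =
      ∑ b : Fin n → Bool, g ((boolFunEquivFin n b : Fin (2 ^ n)) : ℕ) := by
    rw [← Fin.sum_univ_eq_sum_range]
    exact (Equiv.sum_comp (boolFunEquivFin n) (fun k : Fin (2 ^ n) => g (k : ℕ))).symm
  rw [h1]
  -- (2) the pointwise bound on the cube
  have h2 : ∀ b : Fin n → Bool, g ((boolFunEquivFin n b : Fin (2 ^ n)) : ℕ) ≤
      2 * (if (if ArithmeticFunction.liouville ((boolFunEquivFin n b : Fin (2 ^ n)) : ℕ) = -1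
              then (1 : ZMod 2) else 0) =
            MvPolynomial.eval (fun i => if b i then (1 : ZMod 2) else 0) P
          then (1 : ℝ) else 0) - 1 +
        (if ((boolFunEquivFin n b : Fin (2 ^ n)) : ℕ) = 0 then (1 : ℝ) else 0) := by
    intro b
    simp only [hg]
    rw [CorrLeCard.evalPoint_eq b]
    exact CorrLeCard.pointwise _ _
  refine (Finset.sum_le_sum fun b _ => h2 b).trans_eq ?_
  -- (3) sum up: `Σ [agree] = |A|`, `Σ 1 = 2ⁿ`, `Σ [val b = 0] = 1`
  rw [Finset.sum_add_distrib, Finset.sum_sub_distrib, ← Finset.mul_sum,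
    CorrLeCard.sum_ite_val_eq_zero, Finset.sum_boole, Finset.sum_const, Finset.card_univ,
    Fintype.card_fun, Fintype.card_bool, Fintype.card_fin]
  simp
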